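import Literature.NumberTheory.Rogawski1990.CartanObsHasse
import HarnessLib

/-!
# The `χ ≠ 1` class weights `W_x([δ]) = (−1)^{(obs δ)_x}` of the pre-stabilised count (5.4.2)–(5.4.5) EXIST on the adelic conjugacy classes:
# Kottwitz's `cartanObs` is a class function, so the hypothesis `(W, hW)` of ★ `CartanObsHasse` is discharged
(Rogawski, *Automorphic representations of unitary groups in three variables* (1990), §4.3 p. 44 «`Φ^κ(γ, f) = Σ_δ κ(obs δ) Φ(δ, f)`», §5.4
(5.4.2)–(5.4.5) pp. 72–74; Kottwitz, *Stable trace formula: elliptic singular terms*, Math. Ann. 275 (1986), §9)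

Topic `NumberTheory/Rogawski1990`; namespace `Literature.NumberTheory.Rogawski1990`; THEOREMS ONLY (no definition, no instance, no notation, no named
fact, no `sorry`).  Brick «(i)-W» of sub-line R6d ∕ R7 of the FLOOR-0 programme P3a (cell hodgecm-mathlib; F0P3a-plan 09:20:24Z (3)(b)): the count ★
`MatchingAdeleG₂.stableOrbitalSum_map_toAdelic_eq_of_cartanObs` keeps the class weights `W : I → ConjClasses U(H)(𝐀) → ℂ` with
`hW : W x [q.adele] = (−1)^{(cartanObsFun q)_{s x}}` as HYPOTHESES; here such `W` is shown to EXIST (def-free `∃`), because ★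
`MatchingAdeleG₂.cartanObsFun_eq_of_isConjAdele` makes `q ↦ (−1)^{(cartanObsFun q)_{s x}}` constant on `U(H)(𝐀)`-classes, and the count is restated
with `W` bound existentially.  HC_CM is proved only modulo the printed citations until rung 0 closes.

* `MatchingAdeleG₂.neg_one_pow_cartanObsFun_eq_of_mk_adele_eq` — the sign `(−1)^{(cartanObsFun q)_𝔪}` depends only on the class `[q.adele]`.
* **`MatchingAdeleG₂.exists_classWeight`** — `∃ W : I → ConjClasses U(H)(𝐀) → ℂ, ∀ x q, W x [q.adele] = (−1)^{(cartanObsFun q)_{s x}}` (for ANY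
  dictionary `s : I → cartanIndex γ₀`; off the matching classes `W` is `0` — junk, never read).
* **`MatchingAdeleG₂.exists_classWeight_stableOrbitalSum_map_toAdelic_eq`** — ★ `…_eq_of_cartanObs` with `(W, hW)` DISCHARGED:
  `∃ W, (∀ x q, W x [q.adele] = (−1)^{(cartanObsFun q)_{s x}}) ∧ Σ_{[γ] ⊂ 𝒪_st(γ₀)} Φ_m([γ ⊗ 1], f) = (#I + 1)⁻¹ · (Φ^{st,𝐀}(γ₀, f) + Σ_x Φ^{W x}(γ₀, f))`.

## References
* J. D. Rogawski, *Automorphic Representations of Unitary Groups in Three Variables*, Ann. of Math. Stud. 123 (1990), §4.3 p. 44, §5.4 pp. 72–74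
  [Rogawski1990].
* R. E. Kottwitz, *Stable trace formula: elliptic singular terms*, Math. Ann. 275 (1986), 365–399, §9 [Kottwitz1986].
-/

set_option autoImplicit false

noncomputable section

open NumberField IsDedekindDomain
open scoped BigOperators Matrix MatrixGroups

namespace Literature.NumberTheory.Rogawski1990

open Literature.NumberTheory.Automorphic
open Literature.AlgebraicGeometry.ShimuraVarieties (unitaryGroup hermForm)

section ClassWeight

variable {L : Type} [Field L] [NumberField L] [IsCMField L] {H : Matrix (Fin 3) (Fin 3) L} {γ₀ : (UnitaryGroup.cmDatum L 3 H).Rational}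

/-- **The sign `(−1)^{(obs q)_𝔪}` is a class function**: matching adèles with the same `U(H)(𝐀)`-class have the same `cartanObsFun` (★
`MatchingAdeleG₂.cartanObsFun_eq_of_isConjAdele`, ★ `MatchingAdeleG₂.isConjAdele_iff_mk_eq_mk`). [cite: Rogawski1990, §4.3 p. 44; §5.4 p. 72] [cite: Kottwitz1986, §9] -/
theorem MatchingAdeleG₂.neg_one_pow_cartanObsFun_eq_of_mk_adele_eq (hH : (H.map (cmConjRingHom L))ᵀ = H) (hHd : IsUnit H.det)
    (hreg : IsRegularElt ((γ₀ : unitaryGroup (cmConjRingHom L) H).val : GL (Fin 3) L)) {p q : MatchingAdeleG₂ L H H γ₀}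
    (h : ConjClasses.mk p.adele = ConjClasses.mk q.adele) (𝔪 : cartanIndexCM hH hHd hreg) :
    (-1 : ℂ) ^ (p.cartanObsFun hH hHd hreg 𝔪).val = (-1 : ℂ) ^ (q.cartanObsFun hH hHd hreg 𝔪).val := by
  rw [MatchingAdeleG₂.cartanObsFun_eq_of_isConjAdele hH hHd hreg (MatchingAdeleG₂.isConjAdele_iff_mk_eq_mk.2 h)]

/-- **THE `χ ≠ 1` CLASS WEIGHTS EXIST**: for every dictionary `s : I → cartanIndex γ₀` there is `W : I → ConjClasses U(H)(𝐀) → ℂ` with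
`W x [q.adele] = (−1)^{(cartanObsFun q)_{s x}}` for all matching adèles `q` — the hypothesis `(W, hW)` of ★ `MatchingAdeleG₂.stableOrbitalSum_map_toAdelic_eq_of_cartanObs`.
(`W x c := (−1)^{(cartanObsFun q)_{s x}}` for any matching `q` with `[q.adele] = c`, well defined by `neg_one_pow_cartanObsFun_eq_of_mk_adele_eq`; `0` off the
matching classes.) [cite: Rogawski1990, §4.3 p. 44; §5.4 (5.4.3) pp. 72–73] [cite: Kottwitz1986, §9] -/
theorem MatchingAdeleG₂.exists_classWeight (hH : (H.map (cmConjRingHom L))ᵀ = H) (hHd : IsUnit H.det)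
    (hreg : IsRegularElt ((γ₀ : unitaryGroup (cmConjRingHom L) H).val : GL (Fin 3) L)) {I : Type*} (s : I → cartanIndexCM hH hHd hreg) :
    ∃ W : I → ConjClasses (UnitaryGroup.cmDatum L 3 H).Adelic → ℂ,
      ∀ (x : I) (q : MatchingAdeleG₂ L H H γ₀), W x (ConjClasses.mk q.adele) = (-1 : ℂ) ^ (q.cartanObsFun hH hHd hreg (s x)).val := by
  classical
  refine ⟨fun x c => if h : ∃ q : MatchingAdeleG₂ L H H γ₀, ConjClasses.mk q.adele = c
    then (-1 : ℂ) ^ (h.choose.cartanObsFun hH hHd hreg (s x)).val else 0, fun x q => ?_⟩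
  have h : ∃ q' : MatchingAdeleG₂ L H H γ₀, ConjClasses.mk q'.adele = ConjClasses.mk q.adele := ⟨q, rfl⟩
  simp only [dif_pos h]
  exact MatchingAdeleG₂.neg_one_pow_cartanObsFun_eq_of_mk_adele_eq hH hHd hreg h.choose_spec (s x)

end ClassWeight

section ClassWeightCount

variable {L : Type} [Field L] [NumberField L] [IsCMField L] {H : Matrix (Fin 3) (Fin 3) L} {γ₀ : (UnitaryGroup.cmDatum L 3 H).Rational}
variable [∀ g : (UnitaryGroup.cmDatum L 3 H).Adelic,
  MeasurableSpace ((UnitaryGroup.cmDatum L 3 H).Adelic ⧸ Subgroup.centralizer ({g} : Set (UnitaryGroup.cmDatum L 3 H).Adelic))]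

/-- **THE PRE-STABILISATION COUNT (5.4.2)–(5.4.5) WITH THE CLASS WEIGHTS DISCHARGED**, `H` anisotropic: for a dictionary `s : I ↪ cartanIndex γ₀` onto the
degree-one factors there EXIST `χ ≠ 1` class weights `W` with `W x [q.adele] = (−1)^{(cartanObsFun q)_{s x}}`, and for them
`Σ_{[γ] ⊂ 𝒪_st(γ₀)} Φ_m([γ ⊗ 1], f) = (#I + 1)⁻¹ · (Φ^{st,𝐀}(γ₀, f) + Σ_{x ∈ I} adelicKappaOrbitalSum 𝒞′_𝐀(γ₀) (W x) m f)` (★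
`MatchingAdeleG₂.stableOrbitalSum_map_toAdelic_eq_of_cartanObs` ∘ `exists_classWeight`) — every hypothesis of the ★ count except `(s, m, f, hfin)` discharged in house.
[cite: Rogawski1990, §5.4 (5.4.2)–(5.4.5) pp. 72–74; §4.3 p. 44] [cite: Kottwitz1986, §9] -/
theorem MatchingAdeleG₂.exists_classWeight_stableOrbitalSum_map_toAdelic_eq (hH : (H.map (cmConjRingHom L))ᵀ = H) (hHd : IsUnit H.det)
    (hanis : ∀ v : Fin 3 → L, hermForm (cmConjRingHom L) H v v = 0 → v = 0)
    (hreg : IsRegularElt ((γ₀ : unitaryGroup (cmConjRingHom L) H).val : GL (Fin 3) L)) [Fintype (cartanIndexCM hH hHd hreg)]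
    {I : Type*} [Fintype I] (s : I → cartanIndexCM hH hHd hreg) (hs : Function.Injective s)
    (hrange : ∀ 𝔪 : cartanIndexCM hH hHd hreg, (∃ x, s x = 𝔪) ↔ Module.finrank L (↥(cartanSubalgebra γ₀) ⧸ 𝔪.1.asIdeal) = 1)
    (m : OrbitalMeasureFamily (UnitaryGroup.cmDatum L 3 H).Adelic) (f : (UnitaryGroup.cmDatum L 3 H).Adelic → ℂ)
    (hfin : (MatchingAdeleG₂.classes L H H γ₀ ∩ Function.support fun δ => classOrbitalIntegral m f δ).Finite) :
    ∃ W : I → ConjClasses (UnitaryGroup.cmDatum L 3 H).Adelic → ℂ,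
      (∀ (x : I) (q : MatchingAdeleG₂ L H H γ₀), W x (ConjClasses.mk q.adele) = (-1 : ℂ) ^ (q.cartanObsFun hH hHd hreg (s x)).val) ∧
      stableOrbitalSum (cmConjRingHom L) H (fun c => classOrbitalIntegral m f (ConjClasses.map (UnitaryGroup.cmDatum L 3 H).toAdelic c)) γ₀ =
        ((Fintype.card I : ℂ) + 1)⁻¹ * (adelicStableOrbitalSum (MatchingAdeleG₂.classes L H H γ₀) m f +
          ∑ x, adelicKappaOrbitalSum (MatchingAdeleG₂.classes L H H γ₀) (W x) m f) := by
  obtain ⟨W, hW⟩ := MatchingAdeleG₂.exists_classWeight hH hHd hreg s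
  exact ⟨W, hW, MatchingAdeleG₂.stableOrbitalSum_map_toAdelic_eq_of_cartanObs hH hHd hanis hreg s hs hrange W hW m f hfin⟩

end ClassWeightCount

end Literature.NumberTheory.Rogawski1990
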